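import Summits.Schanuel.Schanuel.Theorems.RootDecomp1KGeneric05

/-!
# RootDecomp1K — «GENERIC CELLS», part 06: CF step (i)(c)(d) — Kummer closeness and the exponential budget

`kummer_closeness`: `‖γ^q − y^p‖ ≤ q·(‖e^{uρ}‖+1)^q·δ_B + e^{p‖u‖}·2‖u‖·|ρq − p| + p·(‖e^u‖+1)^p·δ_A` for
`‖e^u − y‖ ≤ δ_A ≤ 1`, `‖e^{uρ} − γ‖ ≤ δ_B ≤ 1`, `‖u‖·|ρq − p| ≤ 1`; `pow_mul_le_exp_pow`: `q^{Ψq} ≤ exp(q^m)`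
(`Ψ ≤ q`, `m ≥ 3`) — the hyper-Liouville error `exp(−q^m)` beats every budget `q^{−Ψq}`; `exists_pow_lt_const_pow`;
and the budget of the proof of CF isolated as real-number lemmas `budget_M/R/close/small/T/Theta/final`
(small contexts, so that the main proof in part 07 elaborates quickly).  Sorry-free; standard axioms; rung 0.
-/

noncomputable section

open Complex Polynomial

namespace Summit.Schanuel.Schanuel.Theorems.RootDecomp1KGeneric

open Summit.Schanuel.Schanuel.Theorems.RootDecomp1KHyper
open Summit.Schanuel.Schanuel.Theorems.RootDecomp1KHyper.HyperCell

section StepOne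

/-! ## CF step (i), part (c): the Kummer closeness estimate and the exponential budget -/

/-- `‖γ^q − y^p‖` against `‖e^{uρ} − γ‖`, `‖e^u − y‖` and `|ρq − p|`. -/
theorem kummer_closeness (u : ℂ) (ρ : ℝ) {y γ : ℂ} {p q : ℕ} {δA δB : ℝ}
    (hy : ‖cexp u - y‖ ≤ δA) (hγ : ‖cexp (u * ρ) - γ‖ ≤ δB) (hδA : δA ≤ 1) (hδB : δB ≤ 1)
    (hsmall : ‖u‖ * |ρ * q - p| ≤ 1) :
    ‖γ ^ q - y ^ p‖ ≤ q * (‖cexp (u * ρ)‖ + 1) ^ q * δB +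
      Real.exp (p * ‖u‖) * (2 * (‖u‖ * |ρ * q - p|)) + p * (‖cexp u‖ + 1) ^ p * δA := by
  set w := cexp u with hw
  set w' := cexp (u * ρ) with hw'
  have hδA0 : 0 ≤ δA := (norm_nonneg _).trans hy
  have hδB0 : 0 ≤ δB := (norm_nonneg _).trans hγ
  -- T1
  have hT1 : ‖γ ^ q - w' ^ q‖ ≤ q * (‖w'‖ + 1) ^ q * δB := by
    refine (norm_pow_sub_pow_le γ w' q).trans ?_
    have hmax : max 1 (max ‖γ‖ ‖w'‖) ≤ ‖w'‖ + 1 := by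
      refine max_le (by linarith [norm_nonneg w']) (max_le ?_ (by linarith))
      have : ‖γ‖ ≤ ‖w'‖ + ‖γ - w'‖ := by
        calc ‖γ‖ = ‖w' + (γ - w')‖ := by ring_nf
          _ ≤ ‖w'‖ + ‖γ - w'‖ := norm_add_le _ _
      rw [norm_sub_rev] at this
      linarith
    have hγw : ‖γ - w'‖ ≤ δB := by rw [norm_sub_rev]; exact hγ
    gcongr
  -- T3
  have hT3 : ‖w ^ p - y ^ p‖ ≤ p * (‖w‖ + 1) ^ p * δA := by
    refine (norm_pow_sub_pow_le w y p).trans ?_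
    have hmax : max 1 (max ‖w‖ ‖y‖) ≤ ‖w‖ + 1 := by
      refine max_le (by linarith [norm_nonneg w]) (max_le (by linarith) ?_)
      have : ‖y‖ ≤ ‖w‖ + ‖y - w‖ := by
        calc ‖y‖ = ‖w + (y - w)‖ := by ring_nf
          _ ≤ ‖w‖ + ‖y - w‖ := norm_add_le _ _
      rw [norm_sub_rev] at this
      linarith
    gcongr
  -- T2
  have hT2 : ‖w' ^ q - w ^ p‖ ≤ Real.exp (p * ‖u‖) * (2 * (‖u‖ * |ρ * q - p|)) := by
    have h1 : w' ^ q = cexp ((p : ℂ) * u) * cexp (u * ((ρ : ℂ) * q - p)) := by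
      rw [hw', ← Complex.exp_nat_mul, ← Complex.exp_add]
      congr 1; ring
    have h2 : w ^ p = cexp ((p : ℂ) * u) := by rw [hw, ← Complex.exp_nat_mul]
    rw [h1, h2, ← mul_sub_one, norm_mul]
    have hn : ‖u * ((ρ : ℂ) * q - p)‖ = ‖u‖ * |ρ * q - p| := by
      rw [norm_mul]
      congr 1
      have : ((ρ : ℂ) * q - p) = ((ρ * q - p : ℝ) : ℂ) := by push_cast; ring
      rw [this, Complex.norm_real, Real.norm_eq_abs]
    have h3 : ‖cexp (u * ((ρ : ℂ) * q - p)) - 1‖ ≤ 2 * ‖u * ((ρ : ℂ) * q - p)‖ :=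
      Complex.norm_exp_sub_one_le (by rw [hn]; exact hsmall)
    rw [hn] at h3
    have h4 : ‖cexp ((p : ℂ) * u)‖ ≤ Real.exp (p * ‖u‖) := by
      rw [Complex.norm_exp]
      refine Real.exp_le_exp.mpr ?_
      calc ((p : ℂ) * u).re ≤ ‖(p : ℂ) * u‖ := Complex.re_le_norm _
        _ = p * ‖u‖ := by rw [norm_mul, Complex.norm_natCast]
    exact mul_le_mul h4 h3 (norm_nonneg _) (Real.exp_pos _).le
  calc ‖γ ^ q - y ^ p‖ = ‖(γ ^ q - w' ^ q) + (w' ^ q - w ^ p) + (w ^ p - y ^ p)‖ := by ring_nf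
    _ ≤ ‖γ ^ q - w' ^ q‖ + ‖w' ^ q - w ^ p‖ + ‖w ^ p - y ^ p‖ := norm_add₃_le
    _ ≤ _ := by linarith

/-- The exponential budget: `q^{Ψ q} ≤ exp(q^m)` for `m ≥ 3`, `q ≥ Ψ`. -/
theorem pow_mul_le_exp_pow {Ψ q m : ℕ} (hΨ : Ψ ≤ q) (hm : 3 ≤ m) :
    (q : ℝ) ^ (Ψ * q) ≤ Real.exp ((q : ℝ) ^ m) := by
  have hq : (q : ℝ) ≤ Real.exp q := by linarith [Real.add_one_le_exp (q : ℝ)]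
  calc (q : ℝ) ^ (Ψ * q) ≤ (Real.exp q) ^ (Ψ * q) := pow_le_pow_left₀ (Nat.cast_nonneg q) hq _
    _ = Real.exp (((Ψ * q : ℕ) : ℝ) * q) := (Real.exp_nat_mul _ _).symm
    _ ≤ Real.exp ((q : ℝ) ^ m) := by
        refine Real.exp_le_exp.mpr ?_
        have hnat : Ψ * q * q ≤ q ^ m := by
          rcases Nat.eq_zero_or_pos q with h | h
          · subst h; simp
          · calc Ψ * q * q ≤ q * q * q := by gcongr
              _ = q ^ 3 := by ring
              _ ≤ q ^ m := Nat.pow_le_pow_right h hm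
        exact_mod_cast hnat

/-- Eventually `q^n < c^q` for `c > 1`. -/
theorem exists_pow_lt_const_pow (n : ℕ) {c : ℝ} (hc : 1 < c) :
    ∃ q₀ : ℕ, ∀ q : ℕ, q₀ ≤ q → (q : ℝ) ^ n < c ^ q := by
  have ht := tendsto_pow_const_div_const_pow_of_one_lt n hc
  have hev := ht.eventually (gt_mem_nhds zero_lt_one)
  obtain ⟨q₀, hq₀⟩ := Filter.eventually_atTop.mp hev
  refine ⟨q₀, fun q hq => ?_⟩
  have h := hq₀ q hq
  have hcq : 0 < c ^ q := pow_pos (by linarith) q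
  rwa [div_lt_one hcq] at h

/-- `Q^a / Q^b ≤ 1 / Q^c` for `a + c ≤ b`, `Q ≥ 1`. -/
theorem pow_mul_inv_pow_le {Q : ℝ} (hQ : 1 ≤ Q) {a b c : ℕ} (h : a + c ≤ b) :
    Q ^ a * (Q ^ b)⁻¹ ≤ (Q ^ c)⁻¹ := by
  have hQ0 : 0 < Q := by linarith
  have hb : 0 < Q ^ b := pow_pos hQ0 b
  have hc : 0 < Q ^ c := pow_pos hQ0 c
  rw [← div_eq_mul_inv, ← one_div, div_le_div_iff₀ hb hc, one_mul, ← pow_add]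
  exact pow_le_pow_right₀ hQ h

/-- `(Q ^ b)⁻¹ ≤ (Q ^ a)⁻¹`. -/
theorem inv_pow_le_inv_pow {Q : ℝ} (hQ : 1 ≤ Q) {a b : ℕ} (h : a ≤ b) : (Q ^ b)⁻¹ ≤ (Q ^ a)⁻¹ := by
  have := pow_mul_inv_pow_le hQ (a := 0) (b := b) (c := a) (by simpa using h)
  simpa using this

/-- From `1/x < Q` (with `x, Q > 0`) conclude `Q⁻¹ < x`. -/
theorem inv_lt_of_one_div_lt {x Q : ℝ} (hx : 0 < x) (hQ : 0 < Q) (h : 1 / x < Q) : Q⁻¹ < x := by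
  have h1 : 1 < Q * x := by rwa [div_lt_iff₀ hx] at h
  rw [inv_eq_one_div, div_lt_iff₀ hQ]
  linarith [mul_comm x Q]

/-! ## CF step (i), part (d): the exponential budget, isolated as real-number lemmas -/

section Budget

variable {Q : ℝ}

/-- Budget lemma: `L · P^D ≤ Q^{2D+1}` when `L ≤ Q` and `P ≤ Q²`. -/
theorem budget_M {L P : ℝ} {D : ℕ} (hQ0 : 0 ≤ Q) (_hL0 : 0 ≤ L) (hL : L ≤ Q) (hP0 : 0 ≤ P)
    (hP : P ≤ Q * Q) : L * P ^ D ≤ Q ^ (2 * D + 1) := by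
  calc L * P ^ D ≤ Q * (Q * Q) ^ D := by gcongr
    _ = Q ^ (2 * D + 1) := by ring

/-- Budget lemma: `(K_A+1)·M_A + (K_B+1)·M_B ≤ Q^{2(D_A+D_B)+3}` under the stated bounds (`Q ≥ 2`). -/
theorem budget_R {MA MB : ℝ} {KA KB DA DB E : ℕ} (hQ2 : 2 ≤ Q) (hMA0 : 0 ≤ MA) (hMB0 : 0 ≤ MB)
    (hMA : MA ≤ Q ^ (2 * DA + 1)) (hMB : MB ≤ Q ^ (2 * DB + 1)) (hKA : (KA : ℝ) + 1 ≤ Q)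
    (hKB : (KB : ℝ) + 1 ≤ Q) (hE : E = 2 * (DA + DB) + 3) :
    ((KA : ℝ) + 1) * MA + ((KB : ℝ) + 1) * MB ≤ Q ^ E := by
  have hQ1 : 1 ≤ Q := by linarith
  have hQ0 : 0 ≤ Q := by linarith
  calc ((KA : ℝ) + 1) * MA + ((KB : ℝ) + 1) * MB
      ≤ Q * Q ^ (2 * DA + 1) + Q * Q ^ (2 * DB + 1) := by gcongr
    _ ≤ Q * Q ^ (2 * (DA + DB) + 1) + Q * Q ^ (2 * (DA + DB) + 1) := by
        have h1 : Q ^ (2 * DA + 1) ≤ Q ^ (2 * (DA + DB) + 1) :=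
          pow_le_pow_right₀ hQ1 (show 2 * DA + 1 ≤ 2 * (DA + DB) + 1 by omega)
        have h2 : Q ^ (2 * DB + 1) ≤ Q ^ (2 * (DA + DB) + 1) :=
          pow_le_pow_right₀ hQ1 (show 2 * DB + 1 ≤ 2 * (DA + DB) + 1 by omega)
        gcongr
    _ = 2 * Q ^ (2 * (DA + DB) + 2) := by ring
    _ ≤ Q * Q ^ (2 * (DA + DB) + 2) := by gcongr
    _ = Q ^ E := by rw [hE]; ring

/-- Root closeness from the hyper-small `Δ`: `x^K ≤ Q^D Λ Δ`, `Δ < Q^{−Ψq}` ⟹ `x < θ = Q^{−Φq}`. -/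
theorem budget_close {Δ θ Λ x : ℝ} {K Ks D E Φ Ψ q : ℕ} (hQ1 : 1 ≤ Q) (hΔ0 : 0 < Δ)
    (hΔΨ : Δ < (Q ^ (Ψ * q))⁻¹) (hθ : θ = (Q ^ (Φ * q))⁻¹) (_hK : 0 < K) (hKs : K ≤ Ks)
    (hDE : D ≤ E) (hΛ : Λ ≤ Q) (hΨ : Ψ = Φ * Ks + E + 1) (hq : 0 < q) (hx0 : 0 ≤ x)
    (hx : x ^ K ≤ Q ^ D * Λ * Δ) : x < θ := by
  have hQ0 : 0 < Q := by linarith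
  have hθ0 : 0 < θ := by rw [hθ]; positivity
  have hΛ0 : 0 ≤ Λ := by
    by_contra hneg
    have h1 : Q ^ D * Λ * Δ < 0 :=
      mul_neg_of_neg_of_pos (mul_neg_of_pos_of_neg (pow_pos hQ0 D) (not_le.mp hneg)) hΔ0
    have h2 : 0 ≤ x ^ K := pow_nonneg hx0 K
    linarith
  have h1 : x ^ K < θ ^ K := by
    calc x ^ K ≤ Q ^ D * Λ * Δ := hx
      _ ≤ Q ^ E * Q * Δ := by
          have h1 : Q ^ D ≤ Q ^ E := pow_le_pow_right₀ hQ1 hDE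
          gcongr
      _ < Q ^ E * Q * (Q ^ (Ψ * q))⁻¹ := by gcongr
      _ = Q ^ (E + 1) * (Q ^ (Ψ * q))⁻¹ := by ring
      _ ≤ (Q ^ (Φ * q * K))⁻¹ := pow_mul_inv_pow_le hQ1 (by
          rw [hΨ]
          have h1 : E + 1 ≤ (E + 1) * q := Nat.le_mul_of_pos_right _ hq
          have h2 : Φ * q * K ≤ Φ * Ks * q := by
            calc Φ * q * K ≤ Φ * q * Ks := Nat.mul_le_mul_left _ hKs
              _ = Φ * Ks * q := by ring
          calc E + 1 + Φ * q * K ≤ (E + 1) * q + Φ * Ks * q := Nat.add_le_add h1 h2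
            _ = (Φ * Ks + E + 1) * q := by ring)
      _ = θ ^ K := by rw [hθ, inv_pow, ← pow_mul]
  exact lt_of_pow_lt_pow_left₀ K hθ0.le h1

/-- Budget lemma: `ν · (Q · Δ) ≤ 1` when `ν ≤ Q`, `Δ < Q^{−Ψq}` and `Ψq ≥ 2` (`Q ≥ 1`). -/
theorem budget_small {Δ ν : ℝ} {Ψ q : ℕ} (hQ1 : 1 ≤ Q) (_hν0 : 0 ≤ ν) (hν : ν ≤ Q)
    (hΔ0 : 0 ≤ Δ) (hΔΨ : Δ < (Q ^ (Ψ * q))⁻¹) (h2 : 2 ≤ Ψ * q) : ν * (Q * Δ) ≤ 1 := by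
  have hQ0 : 0 < Q := by linarith
  have hΔ2 : Δ ≤ Q⁻¹ * Q⁻¹ := by
    have h := lt_of_lt_of_le hΔΨ (inv_pow_le_inv_pow hQ1 h2)
    rw [pow_two, mul_inv] at h; exact h.le
  calc ν * (Q * Δ) ≤ Q * (Q * (Q⁻¹ * Q⁻¹)) := by gcongr
    _ = 1 := by field_simp

/-- The three terms of `kummer_closeness` are each `≤ Q^{(c₀+2)q} θ` (`Q = q`). -/
theorem budget_T {θ Δ a b ν : ℝ} {p q c₀ : ℕ} (hQq : Q = q) (hQ1 : 1 ≤ Q) (hθ0 : 0 < θ)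
    (hΔθ : Δ ≤ θ) (hΔ0 : 0 ≤ Δ) (ha0 : 0 ≤ a) (hb0 : 0 ≤ b) (hν0 : 0 ≤ ν) (ha : a + 1 ≤ Q)
    (hb : b + 1 ≤ Q) (hexp : Real.exp ν ≤ Q) (hν : 2 * ν ≤ Q) (hc₀ : (c₀ : ℝ) ≤ Q)
    (hc₀2 : 2 ≤ c₀) (hp : p ≤ c₀ * q) (hq : 0 < q) :
    (q : ℝ) * (b + 1) ^ q * θ + Real.exp (p * ν) * (2 * (ν * (Q * Δ))) + p * (a + 1) ^ p * θ ≤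
      3 * (Q ^ ((c₀ + 2) * q) * θ) := by
  have hQ0 : 0 ≤ Q := by linarith
  have hpQ : (p : ℝ) ≤ (c₀ : ℝ) * Q := by rw [hQq]; exact_mod_cast hp
  have he1 : q + 1 ≤ (c₀ + 2) * q := by nlinarith
  have he2 : p + 2 ≤ (c₀ + 2) * q := by nlinarith
  have he3 : c₀ * q + 2 ≤ (c₀ + 2) * q := by nlinarith
  have hT1 : (q : ℝ) * (b + 1) ^ q * θ ≤ Q ^ ((c₀ + 2) * q) * θ := by
    refine mul_le_mul_of_nonneg_right ?_ hθ0.le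
    calc (q : ℝ) * (b + 1) ^ q ≤ Q * Q ^ q := by rw [← hQq]; gcongr
      _ = Q ^ (q + 1) := by ring
      _ ≤ Q ^ ((c₀ + 2) * q) := pow_le_pow_right₀ hQ1 he1
  have hT2 : Real.exp (p * ν) * (2 * (ν * (Q * Δ))) ≤ Q ^ ((c₀ + 2) * q) * θ := by
    calc Real.exp (p * ν) * (2 * (ν * (Q * Δ)))
        = (Real.exp ν) ^ p * ((2 * ν) * Q * Δ) := by rw [← Real.exp_nat_mul]; ring
      _ ≤ Q ^ p * (Q * Q * θ) := by gcongr
      _ = Q ^ (p + 2) * θ := by ring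
      _ ≤ Q ^ ((c₀ + 2) * q) * θ := by
          have h1 : Q ^ (p + 2) ≤ Q ^ ((c₀ + 2) * q) := pow_le_pow_right₀ hQ1 he2
          gcongr
  have hT3 : (p : ℝ) * (a + 1) ^ p * θ ≤ Q ^ ((c₀ + 2) * q) * θ := by
    refine mul_le_mul_of_nonneg_right ?_ hθ0.le
    calc (p : ℝ) * (a + 1) ^ p ≤ ((c₀ : ℝ) * Q) * Q ^ p := by gcongr
      _ ≤ (Q * Q) * Q ^ (c₀ * q) := by
          have h1 : Q ^ p ≤ Q ^ (c₀ * q) := pow_le_pow_right₀ hQ1 hp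
          gcongr
      _ = Q ^ (c₀ * q + 2) := by ring
      _ ≤ Q ^ ((c₀ + 2) * q) := pow_le_pow_right₀ hQ1 he3
  linarith

/-- The exactness threshold: `(2 (cR)^{p+q})^κ ≤ Q^{Φ₁ q}`, `Φ₁ = 4 E c₀ κ`. -/
theorem budget_Theta {c R : ℝ} {E c₀ κ p q Φ₁ : ℕ} (hQ2 : 2 ≤ Q) (hc1 : 1 ≤ c)
    (hc : c ≤ Q ^ E * Q ^ E) (hR1 : 1 ≤ R) (hR : R ≤ Q ^ E) (hpq : p + q ≤ c₀ * q) (hE : 1 ≤ E)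
    (hc₀ : 1 ≤ c₀) (hq : 0 < q) (hΦ₁ : Φ₁ = 4 * E * c₀ * κ) :
    (2 * (c * R) ^ (p + q)) ^ κ ≤ Q ^ (Φ₁ * q) := by
  have hQ1 : 1 ≤ Q := by linarith
  have hQ0 : 0 ≤ Q := by linarith
  have hcR1 : 1 ≤ c * R := one_le_mul_of_one_le_of_one_le hc1 hR1
  calc (2 * (c * R) ^ (p + q)) ^ κ ≤ (2 * ((Q ^ E * Q ^ E) * Q ^ E) ^ (c₀ * q)) ^ κ := by
        gcongr (2 * ?_) ^ _
        calc (c * R) ^ (p + q) ≤ (c * R) ^ (c₀ * q) := pow_le_pow_right₀ hcR1 hpq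
          _ ≤ ((Q ^ E * Q ^ E) * Q ^ E) ^ (c₀ * q) := by
              have h1 : c * R ≤ (Q ^ E * Q ^ E) * Q ^ E :=
                mul_le_mul hc hR (by linarith) (by positivity)
              exact pow_le_pow_left₀ (le_trans zero_le_one hcR1) h1 _
    _ = (2 * Q ^ (3 * E * (c₀ * q))) ^ κ := by ring
    _ ≤ (Q * Q ^ (3 * E * (c₀ * q))) ^ κ := by gcongr
    _ = Q ^ ((3 * E * (c₀ * q) + 1) * κ) := by rw [← pow_succ', ← pow_mul]
    _ ≤ Q ^ (Φ₁ * q) := pow_le_pow_right₀ hQ1 (by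
        rw [hΦ₁]
        have h1 : 1 ≤ E * c₀ * q := one_le_mul (one_le_mul hE hc₀) hq
        have h2 : κ ≤ E * c₀ * q * κ := Nat.le_mul_of_pos_left κ h1
        calc (3 * E * (c₀ * q) + 1) * κ = 3 * (E * c₀ * q * κ) + κ := by ring
          _ ≤ 3 * (E * c₀ * q * κ) + E * c₀ * q * κ := Nat.add_le_add_left h2 _
          _ = 4 * E * c₀ * κ * q := by ring)

/-- The final comparison: `3 Q^{(c₀+2)q} / Q^{Φ q} < 1 / Q^{Φ₁ q}` for `Φ = (c₀+2) + Φ₁ + 1`, `Q ≥ 3`,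
`q ≥ 2`. -/
theorem budget_final {c₀ Φ Φ₁ q : ℕ} (hQ3 : 3 ≤ Q) (hq : 2 ≤ q) (hΦ : Φ = (c₀ + 2) + Φ₁ + 1) :
    3 * (Q ^ ((c₀ + 2) * q) * (Q ^ (Φ * q))⁻¹) < (Q ^ (Φ₁ * q))⁻¹ := by
  have hQ0 : 0 < Q := by linarith
  have hQ1 : 1 ≤ Q := by linarith
  have hlt : (3 : ℝ) < Q ^ q := by
    calc (3 : ℝ) < 9 := by norm_num
      _ ≤ Q ^ 2 := by nlinarith
      _ ≤ Q ^ q := pow_le_pow_right₀ hQ1 hq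
  have hΦq : Φ * q = (c₀ + 2) * q + Φ₁ * q + q := by rw [hΦ]; ring
  rw [hΦq, pow_add, pow_add, mul_inv, mul_inv]
  have hQc0 : 0 < Q ^ ((c₀ + 2) * q) := pow_pos hQ0 _
  have hQΦ₁ : 0 < Q ^ (Φ₁ * q) := pow_pos hQ0 _
  have hQq : 0 < Q ^ q := pow_pos hQ0 _
  calc 3 * (Q ^ ((c₀ + 2) * q) * ((Q ^ ((c₀ + 2) * q))⁻¹ * (Q ^ (Φ₁ * q))⁻¹ * (Q ^ q)⁻¹))
      = 3 * (Q ^ q)⁻¹ * (Q ^ (Φ₁ * q))⁻¹ := by field_simp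
    _ < 1 * (Q ^ (Φ₁ * q))⁻¹ := by
        refine mul_lt_mul_of_pos_right ?_ (inv_pos.mpr hQΦ₁)
        rw [← div_eq_mul_inv, div_lt_one hQq]; exact hlt
    _ = (Q ^ (Φ₁ * q))⁻¹ := one_mul _

end Budget

end StepOne

end Summit.Schanuel.Schanuel.Theorems.RootDecomp1KGeneric
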